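import Literature.Geometry.Lorentzian.NonRotatingBlackHoleUniqueness
import Literature.Geometry.Lorentzian.AxisymmetricBlackHoleUniqueness
import HarnessLib

/-!
# Chruściel–Costa's uniqueness theorem (Thm. 1.3): the printed case split — rotating case, non-rotating horizon, and the assembly with Sudarsky–Wald and the static uniqueness theorem

Topic `Literature/Geometry/Lorentzian`. Fact-decomposition record (librarian, fact-decompose,
2026-08-16) for the named fact `Literature.Geometry.Lorentzian.ChruscielCosta2008_uniqueness`
(P. T. Chruściel, J. L. Costa, *On uniqueness of stationary vacuum black holes*, Astérisque 321
(2008) = arXiv:0806.0016, Thm. 1.3: an `I⁺`-regular, analytic, vacuum stationary AF black hole with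
connected non-degenerate horizon has domain of outer communications isometric to a Kerr exterior;
`StationaryBlackHoleUniqueness.lean`), an XL fact that ran to the prover budget cap. Its proofs file
(`StationaryBlackHoleUniquenessProofs.lean`) collects the causal-theoretic steps of §§2–4; the
theorem itself is, in print, a synthesis proved in §7 (arXiv p. 34):

> "If `𝓔⁺` is empty, … Otherwise the proof splits into two cases, according to whether or not `X`
> is tangent to the generators of `𝓔⁺`, to be covered separately in Sections 7.1 and 7.2."
> §7.1 (Rotating horizons): Thm. 4.14 (Hawking's rigidity: the isometry group contains
> `ℝ × U(1)`), Cor. 4.7 (`⟨⟨M_ext⟩⟩` simply connected), Thm. 4.6, the global Weyl–Papapetrou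
> representation of §5 and the harmonic-map analysis of §6 (Thm. 6.1 with Cor. 6.3) "allow us to
> conclude". §7.2 (Non-rotating case): "By hypothesis `∇(g(X, X))` has no zeros on `𝓔⁺`, so all
> components of the future event horizon are non-degenerate"; the d.o.c. is shown STATIC (bifurcate
> horizon attached by Rácz–Wald, maximal Cauchy surface of Chruściel–Wald, the Sudarsky–Wald
> identity `∫ N K^{ij}K_{ij} = 0`), "and Theorem 1.4 allows us to conclude that `⟨⟨M_ext⟩⟩` is
> Schwarzschildian."

The two steps of §7.2 are ALREADY named facts of the tree — `SudarskyWald1993_staticity`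
(non-rotating, non-degenerate ⟹ the stationary Killing field `T` is hypersurface-orthogonal on
`⟨⟨M_ext⟩⟩`) and `ChruscielGalloway2010_docStaticUniqueness` (static d.o.c. ⟹ Schwarzschild; Thm. 1.4
as applied in §7.2, analyticity removed by Chruściel–Galloway 2010), both in
`NonRotatingBlackHoleUniqueness.lean`, with Schwarzschild ⊂ Kerr the tree's theorem
`IsIsometricToSchwarzschildExterior.isIsometricToKerrExterior`. What remains is named here, along the
printed case split ("`X` tangent to the generators of `𝓔⁺`" is rendered, `X = T = 𝓑.killing` being
tangent to the invariant hypersurface `𝓔⁺`, as "`T` is null on `𝓔⁺`": `g(T, T) = 0` at every point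
of `𝓑.horizon`; a vector tangent to a null hypersurface is null iff it is proportional to the
generator):

* `ChruscielCosta2008_uniqueness_rotatingCase` — **the rotating case of Thm. 1.3** (§7.1): under the
  hypotheses of the fact, if `g(T, T) ≠ 0` somewhere on `𝓔⁺` then `⟨⟨M_ext⟩⟩` is isometric to a
  subextremal Kerr exterior (Thm. 4.14, §5, §6 Thm. 6.1 / Cor. 6.3; this is where analyticity and
  Weinstein's harmonic-map uniqueness enter);
* `ChruscielCosta2008_nonRotating_horizonKilling` — **the opening of the non-rotating case** (§7.2
  ¶1 with §2.3 (2.8)–(2.10), Cor. 3.3 / Cor. 3.8 and Thm. 4.11): under the hypotheses of the fact, if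
  `T` is null on `𝓔⁺` then `T` itself is a non-degenerate horizon Killing field — nowhere zero on
  `𝓔⁺` with `∇_T T = κ T` on `𝓔⁺` for one constant `κ ≠ 0` — which is verbatim the horizon
  hypothesis of `SudarskyWald1993_staticity`. (For the tree's `IsNonDegenerateHorizon`, whose
  Killing field `K` is then null, hence parallel to `T` on `𝓔⁺`, this is the zeroth law for `T` and
  the observation that `κ_T = 0` would force the ratio `K/T` to vanish somewhere along each complete
  orbit of `T` in `𝓔⁺`.)

The assembly `ChruscielCosta2008_uniqueness_holds_of` proves the fact AT UNIVERSE `0` (the universe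
of `SudarskyWald1993_staticity` / `ChruscielGalloway2010_docStaticUniqueness` and of the route
statements the fact serves) by the printed case split.

## References

* [ChruscielCosta2008] P. T. Chruściel, J. L. Costa, Astérisque 321 (2008) 195–265
  (arXiv:0806.0016): Thm. 1.3, Thm. 1.4, §2.3 ((2.8)–(2.10)), §3 (Cor. 3.3, Cor. 3.8), §4 (Thm. 4.6,
  Cor. 4.7, Thm. 4.11, Thm. 4.13–4.14), §5, §6 (Thm. 6.1, Cor. 6.3), §7 (7.1, 7.2).
* [ChruscielCostaHeusler2012] P. T. Chruściel, J. L. Costa, M. Heusler, Living Rev. Relativity 15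
  (2012) 7, §3.2–3.3.
* [ChruscielGalloway2010] P. T. Chruściel, G. J. Galloway, Class. Quantum Grav. 27 (2010) 152001,
  Thm. 1.1, Thm. 4.1.
* [Heusler1996] M. Heusler, *Black Hole Uniqueness Theorems*, CUP 1996, §6.1–6.3 (Killing horizons,
  zeroth law).
-/

noncomputable section

open scoped Manifold ContDiff

universe u

namespace Literature.Geometry.Lorentzian

/-! ### The two remaining pieces of the printed proof, named -/

/-- **Chruściel–Costa 2008, Thm. 1.3, ROTATING case (§7.1).** Let `𝓑` be a stationary AF black
hole (`StationaryAFBlackHole`) which is `I⁺`-regular, analytic and vacuum, with connected,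
non-degenerate future event horizon `𝓔⁺ = 𝓑.horizon` (the hypotheses of
`ChruscielCosta2008_uniqueness`, with the prelude's standing facts `hF hP hres`), and suppose the
stationary Killing field `T = 𝓑.killing` is NOT everywhere tangent to the null generators of `𝓔⁺`,
i.e. `g(T, T) ≠ 0` at some point of `𝓔⁺` ("rotating horizon"). Then `⟨⟨M_ext⟩⟩` is isometric to a
subextremal Kerr exterior (`IsIsometricToKerrExterior`). Printed proof, §7.1: "Theorem 4.14 shows
that the isometry group of `(M, g)` contains `ℝ × U(1)`. By Corollary 4.7 `⟨⟨M_ext⟩⟩` is simply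
connected so that, in view of Theorem 4.6, the analysis of Section 5 applies, leading to the global
representation [of §5] of the metric. The analysis of the behavior near the symmetry axis of the
harmonic map `Φ` of Section [6] shows that `Φ` lies a finite distance from one of the solutions of
Theorem 6.1, and the uniqueness part of that last theorem allows us to conclude; compare Corollary
6.3" — Hawking–Hollands–Ishibashi–Wald rigidity (analyticity), the orbit-space structure and
Weinstein's harmonic-map theory; non-degeneracy makes the Kerr member subextremal.
[cite: ChruscielCosta2008, §7.1 with Thm. 4.14, Thm. 4.6, Cor. 4.7, §5 and §6 (Thm. 6.1, Cor. 6.3)]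
[cite: ChruscielCostaHeusler2012, §3.2 and Thm. 3.2] -/
def ChruscielCosta2008_uniqueness_rotatingCase : Prop :=
  ∀ (𝓑 : StationaryAFBlackHole.{u}) [𝓑.metric.HasLeviCivita] [Kerr.Facts]
    (hF : 𝓑.metric.isOpen_chronologicalFuture 𝓑.timeOrientation)
    (hP : 𝓑.metric.isOpen_chronologicalPast 𝓑.timeOrientation)
    (hres : PseudoRiemannianMetric.contMDiff_restrict (I := 𝓡 4) (n := ∞) (M := 𝓑.carrier)),
    𝓑.IsIPlusRegular → 𝓑.IsAnalytic → 𝓑.metric.toPseudoRiemannianMetric.IsRicciFlat →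
    IsConnected 𝓑.horizon → 𝓑.toSpacetime.IsNonDegenerateHorizon 𝓑.Mext →
    (∃ p ∈ 𝓑.horizon, 𝓑.metric.val p (𝓑.killing p) (𝓑.killing p) ≠ 0) →
    𝓑.IsIsometricToKerrExterior hF hP hres

/-- **Chruściel–Costa 2008, §7.2, first paragraph: in the NON-ROTATING case the stationary Killing
field is itself a non-degenerate horizon Killing field.** Let `𝓑` be a stationary AF black hole
which is `I⁺`-regular, analytic and vacuum, with connected future event horizon `𝓔⁺` which is
non-degenerate in the tree's sense (`IsNonDegenerateHorizon`: SOME Killing field `K`, nowhere zero on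
and tangent to `𝓔⁺`, with `∇_K K = κ K` on `𝓔⁺`, `κ ≠ 0`), and suppose `T = 𝓑.killing` is tangent
to the null generators of `𝓔⁺`, i.e. null on `𝓔⁺` (`g(T, T) = 0` at every point of `𝓑.horizon`;
"the case where the stationary Killing vector `X` is tangent to the generators of every component of
`𝓗⁺` will be referred to as the non-rotating one"). Then `T` has no zeros on `𝓔⁺` and
`∇_T T = κ' T` on `𝓔⁺` for a single NON-ZERO constant `κ'` — verbatim the horizon hypothesis of
`SudarskyWald1993_staticity`. In print: `T` has no zeros on the closure of the d.o.c. (Cor. 3.3,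
Cor. 3.8) and `𝓔⁺ = ⋃ₜ φₜ(∂S̄)` is a smooth `T`-invariant null hypersurface (Thm. 4.11), hence a
Killing horizon of `T` with surface gravity `κ'` defined by (2.8), `d(g(T, T)) = −2κ' T♭`, constant
on the connected `𝓔⁺` (zeroth law, (2.9)–(2.10)); "By hypothesis `∇(g(X, X))` has no zeros on `𝓔⁺`,
so all components of the future event horizon are non-degenerate" (`κ' ≠ 0`). For the tree's
existential horizon hypothesis: `K` is null on `𝓔⁺` (`0 = g(∇_K K, K) = κ g(K, K)`,
`IsKillingField.val_self_eq_zero_of_leviCivita_eq_smul`), so `K = f T` along `𝓔⁺`, and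
`T(f) + f κ' = κ` there; `κ' = 0` would make `f` affine, hence vanishing, along each complete
`T`-orbit in `𝓔⁺`, contradicting `K ≠ 0`. [cite: ChruscielCosta2008, §7.2 (first paragraph) with §2.3 (2.8)–(2.10), Cor. 3.3, Cor. 3.8 and Thm. 4.11]
[cite: Heusler1996, §6.1–6.3] -/
def ChruscielCosta2008_nonRotating_horizonKilling : Prop :=
  ∀ (𝓑 : StationaryAFBlackHole.{u}) [𝓑.metric.HasLeviCivita],
    𝓑.IsIPlusRegular → 𝓑.IsAnalytic → 𝓑.metric.toPseudoRiemannianMetric.IsRicciFlat →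
    IsConnected 𝓑.horizon → 𝓑.toSpacetime.IsNonDegenerateHorizon 𝓑.Mext →
    (∀ p ∈ 𝓑.horizon, 𝓑.metric.val p (𝓑.killing p) (𝓑.killing p) = 0) →
    (∀ p ∈ 𝓑.horizon, 𝓑.killing p ≠ 0) ∧
      ∃ κ : ℝ, κ ≠ 0 ∧ ∀ p ∈ 𝓑.horizon,
        𝓑.metric.leviCivita 𝓑.killing p (𝓑.killing p) = κ • 𝓑.killing p

/-! ### The assembly (universe `0`) -/

/-- **Chruściel–Costa's Theorem 1.3 at universe `0` from its four named leaves, by the printed case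
split of §7** (fact-decomposition glue, canonical name): if `T` is not null somewhere on `𝓔⁺`, the
rotating case (`ChruscielCosta2008_uniqueness_rotatingCase`, §7.1) concludes; otherwise `T` is a
non-degenerate horizon Killing field (`ChruscielCosta2008_nonRotating_horizonKilling`, §7.2 ¶1),
the d.o.c. is static (`SudarskyWald1993_staticity`, §7.2), hence Schwarzschildian
(`ChruscielGalloway2010_docStaticUniqueness`, Thm. 1.4 as applied in §7.2), hence a Kerr exterior
with `a = 0` (`IsIsometricToSchwarzschildExterior.isIsometricToKerrExterior`). The horizon is
non-empty because it is connected. [cite: ChruscielCosta2008, §7 (proof of Thm. 1.3: 7.1 and 7.2), Thm. 1.4] -/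
theorem ChruscielCosta2008_uniqueness_holds_of
    (hrot : ChruscielCosta2008_uniqueness_rotatingCase.{0})
    (hnr : ChruscielCosta2008_nonRotating_horizonKilling.{0})
    (hSW : SudarskyWald1993_staticity) (hCG : ChruscielGalloway2010_docStaticUniqueness) :
    ChruscielCosta2008_uniqueness.{0} := by
  intro 𝓑 _ _ hF hP hres hreg hω hvac hconn hnd
  by_cases h : ∃ p ∈ 𝓑.horizon, 𝓑.metric.val p (𝓑.killing p) (𝓑.killing p) ≠ 0
  · exact hrot 𝓑 hF hP hres hreg hω hvac hconn hnd h
  · push Not at h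
    obtain ⟨hT0, hκ⟩ := hnr 𝓑 hreg hω hvac hconn hnd h
    have hstat := hSW 𝓑 hreg hvac hconn.nonempty hT0 hκ
    exact (hCG 𝓑 hF hP hres hreg hstat hvac hconn.nonempty).isIsometricToKerrExterior

/-! ### The rotating case from the axisymmetric theorem and Hawking's rigidity (§7.1) -/

/-- **The rotating case of Thm. 1.3 is Chruściel–Costa–Heusler's axisymmetric Theorem 3.2 composed
with Hawking's rigidity theorem** (Chruściel–Costa 2008, §7.1: "Theorem 4.14 shows that the
isometry group of `(M, g)` contains `ℝ × U(1)`. … in view of Theorem 4.6, the analysis of Section 5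
applies"; Chruściel–Costa–Heusler 2012, §3.3.1: "In the rotating case, Theorem 3.4 [rigidity]
… the next key step is provided by Theorem 3.2"): given the named fact
`ChruscielCostaHeusler2012_axisymmetricUniqueness` (`AxisymmetricBlackHoleUniqueness.lean`: the
`I⁺`-regular, vacuum, connected non-degenerate, STATIONARY-AXISYMMETRIC case, no analyticity) and
the rigidity step "an analytic, `I⁺`-regular, vacuum stationary AF black hole with connected
non-degenerate horizon on which `T` is somewhere non-null carries an axisymmetric Killing field
commuting with `T`" (Chruściel–Costa 2008, Thm. 4.14 with §4.4 and Beig–Chruściel 1997; Hawking–Ellis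
1973, Prop. 9.3.6 — taken here as the explicit hypothesis `hrig`: the rigidity theorem is not
vendored in `Literature/`, its analyticity-free version being an open problem recorded under
`Summits/`), the leaf `ChruscielCosta2008_uniqueness_rotatingCase` follows. This records the
dependency between the two fact decompositions: of the four leaves of
`ChruscielCosta2008_uniqueness_holds_of`, the rotating one reduces to Thm. 3.2 plus rigidity.
[cite: ChruscielCosta2008, §7.1 (with Thm. 4.14)] [cite: ChruscielCostaHeusler2012, §3.3.1 and Thm. 3.2] -/
theorem ChruscielCosta2008_uniqueness_rotatingCase.of_axisymmetricUniqueness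
    (hax : ChruscielCostaHeusler2012_axisymmetricUniqueness.{u})
    (hrig : ∀ (𝓑 : StationaryAFBlackHole.{u}) [𝓑.metric.HasLeviCivita],
      𝓑.IsIPlusRegular → 𝓑.IsAnalytic → 𝓑.metric.toPseudoRiemannianMetric.IsRicciFlat →
      IsConnected 𝓑.horizon → 𝓑.toSpacetime.IsNonDegenerateHorizon 𝓑.Mext →
      (∃ p ∈ 𝓑.horizon, 𝓑.metric.val p (𝓑.killing p) (𝓑.killing p) ≠ 0) →
      𝓑.IsStationaryAxisymmetric) :
    ChruscielCosta2008_uniqueness_rotatingCase.{u} := by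
  intro 𝓑 _ _ hF hP hres hreg hω hvac hconn hnd hrot
  exact hax 𝓑 hF hP hres ⟨⟨hreg, hconn, fun {_} ↦ hnd⟩, hrig 𝓑 hreg hω hvac hconn hnd hrot⟩ hvac

/-- **Chruściel–Costa's Theorem 1.3 at universe `0` from the axisymmetric theorem, rigidity, and
the two non-rotating leaves** (printed architecture of §7 with §7.1 unfolded one step further:
rigidity ⟶ Thm. 3.2 of Chruściel–Costa–Heusler in the rotating case; Sudarsky–Wald staticity ⟶
static uniqueness in the non-rotating case). [cite: ChruscielCosta2008, §7 (7.1 and 7.2)] [cite: ChruscielCostaHeusler2012, §3.3.1, Thm. 3.2 and Thm. 3.1] -/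
theorem ChruscielCosta2008_uniqueness_holds_of_axisymmetricUniqueness
    (hax : ChruscielCostaHeusler2012_axisymmetricUniqueness.{0})
    (hrig : ∀ (𝓑 : StationaryAFBlackHole.{0}) [𝓑.metric.HasLeviCivita],
      𝓑.IsIPlusRegular → 𝓑.IsAnalytic → 𝓑.metric.toPseudoRiemannianMetric.IsRicciFlat →
      IsConnected 𝓑.horizon → 𝓑.toSpacetime.IsNonDegenerateHorizon 𝓑.Mext →
      (∃ p ∈ 𝓑.horizon, 𝓑.metric.val p (𝓑.killing p) (𝓑.killing p) ≠ 0) →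
      𝓑.IsStationaryAxisymmetric)
    (hnr : ChruscielCosta2008_nonRotating_horizonKilling.{0})
    (hSW : SudarskyWald1993_staticity) (hCG : ChruscielGalloway2010_docStaticUniqueness) :
    ChruscielCosta2008_uniqueness.{0} :=
  ChruscielCosta2008_uniqueness_holds_of
    (ChruscielCosta2008_uniqueness_rotatingCase.of_axisymmetricUniqueness hax hrig) hnr hSW hCG

end Literature.Geometry.Lorentzian

end
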